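import Mathlib
import HarnessLib
import HarnessLib.Audit
import Summits.NavierStokesRegularity.Statement
import Literature.Analysis.FluidPDE.MildSolutions
import Literature.Analysis.FluidPDE.RusinSverakCompactness

/-!
Route: AxisymmetricExtremality

DORMANT since 2026-09-04T08:37:37Z (reconciler: no traction for 5 d (last activity item-evidence-added at 2026-08-30T07:51:28Z); parked, not closed — `ledger route dormant route-NavierStokesRegularity-AxisymmetricExtremality --off` to r) — unstaffed, not closed; items shared with open routes are served there. `ledger route dormant <id> --off` reactivates.

# Route AxisymmetricExtremality — the cheapest singularity is axisymmetric — Smith fixed points on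
the Rusin–Šverák moduli space reduce Clay (A) to AX

X = AXB ∧ AX_H ("it suffices to show X"; resurrects the 2001 line
`summits/ns/routes/minimal-blowup-symmetry`, STATUS proving, nothing refereed beyond its junction
rows). AXB (EXTREMALITY OF SYMMETRY): for every ν > 0, if Clay (A) fails at viscosity ν — some
smooth, divergence-free, rapidly decaying datum admits no jointly smooth bounded-energy global
solution; then (Kato→Clay, PROVED in tree as `clay_solution_of_hasGlobalKatoSolution_holds`) that
datum has no global Kato solution, so the Ḣ^{1/2} threshold ρ_max^pure(ν) is finite and
Rusin–Šverák's set M of minimal blow-up data (Ḣ^{1/2} data of norm exactly ρ_max^pure without a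
global Kato solution) is non-empty and compact modulo translations and scalings, both PROVED in tree
— then SOME minimal blow-up datum is axisymmetric: the cheapest singularity is a symmetric one (ρ_ax
= ρ_max). AX_H (REGULARITY UNDER SYMMETRY): every weakly divergence-free axisymmetric Ḣ^{1/2} datum
has a global Kato (C_t L³) solution — the critical-space form of the axisymmetric-with-swirl problem
ns.S25. AXB is reached by the two ranked cruxes MinimalDatumPFold (the fixed-point output: p-fold
symmetric minimal data for unboundedly many p) and PFoldToAxisymmetric (compactness upgrade). TYPING
(rev 2, cone repair): in every item "axisymmetric about the x₂-axis" / "p-fold symmetric" is written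
OUT as equivariance under the rotation R_θ x = (cos θ x₀ − sin θ x₁, sin θ x₀ + cos θ x₁, x₂) (θ
arbitrary, resp. θ = 2π/p) — this is `Literature.Analysis.FluidPDE.IsAxisymmetric u₀` / `u₀ (rotZ θ
x) = rotZ θ (u₀ x)` unfolded DEFINITIONALLY (`Iff.rfl`, checked in Sketch.lean), so provers bridge
to the tree's axisymmetric API by `Iff.rfl`; the route file thereby imports only `MildSolutions` +
`RusinSverakCompactness` (import cone: 27 project modules, no
AxisymmetricEuler/Vorticity/NSKatoToClayHolds).
Lean: `(∀ ν : ℝ, 0 < ν → (∃ v₀, ContDiff ℝ ⊤ v₀ ∧ NSWave0.IsDivFree v₀ ∧ HasRapidSpatialDecay v₀ ∧ ¬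
∃ u p, IsSmoothOnHalfSpace u ∧ IsSmoothOnHalfSpace p ∧ IsNavierStokesSolution ν 0 v₀ u p ∧
HasBoundedEnergy u) → ∃ (u₀ : EuclideanSpace ℝ (Fin 3) → EuclideanSpace ℝ (Fin 3)) (g :
Literature.Analysis.FunctionSpaces.HomSobolev (EuclideanSpace ℝ (Fin 3)) (EuclideanSpace ℂ (Fin 3))
(1 / 2 : ℝ)), Literature.Analysis.FluidPDE.IsMinimalBlowupDatum ν u₀ g ∧
Literature.Analysis.FluidPDE.IsAxisymmetric u₀) ∧ (∀ ν : ℝ, 0 < ν → ∀ u₀ g, MeasureTheory.MemLp u₀ 3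
MeasureTheory.volume → g.Represents (Literature.Analysis.FunctionSpaces.EuclideanSpace.complexify ∘
u₀) → Literature.Analysis.FluidPDE.IsWeaklyDivFree u₀ → Literature.Analysis.FluidPDE.IsAxisymmetric
u₀ → Literature.Analysis.FluidPDE.HasGlobalKatoSolution ν u₀)` — item `Thesis` is this Prop with
`IsAxisymmetric u₀` unfolded to `∀ θ x, u₀ (WithLp.toLp 2 ![Real.cos θ * x 0 - Real.sin θ * x 1,
Real.sin θ * x 0 + Real.cos θ * x 1, x 2]) = WithLp.toLp 2 ![Real.cos θ * u₀ x 0 - Real.sin θ * u₀ x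
1, Real.sin θ * u₀ x 0 + Real.cos θ * u₀ x 1, u₀ x 2]`.

## Assembly
Pure logic, kernel-checked (`closes`, 0 sorry, no Literature lemma, rev 2): fix ν > 0 and a Clay
datum u₀; suppose it has no Clay solution. Then Clay (A) fails at ν, so MinimalDatumPFold gives
p-fold symmetric minimal blow-up data for unboundedly many p, PFoldToAxisymmetric an axisymmetric
minimal blow-up datum (u₁, g), and AxisymmetricKatoGlobal a global Kato solution of u₁ —
contradicting the clause `¬HasGlobalKatoSolution ν u₁` of `IsMinimalBlowupDatum`. Hence the Clay
solution exists: `NavierStokesRegularity`. The routine reductions Clay-failure ⇒ no global Kato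
solution (Kato→Clay, `clay_solution_of_hasGlobalKatoSolution_holds`) ⇒ ρ_max^pure(ν) < ⊤
(ClayDatumCritical + `hasGlobalKatoSolution_of_lt_rusinSverakRhoMaxPure`) ⇒ M ≠ ∅ compact
(`rusin_sverak_minimal_blowup_holds`, `rusin_sverak_minimal_data_compact_holds`) now live INSIDE the
proof of MinimalDatumPFold (Theorems side), not in the route file.

Rationale: WHY THIS LINE. If Clay (A) fails in the critical space, Rusin–Šverák (arXiv:0911.0500 Cor 4.3, in
tree as `rusin_sverak_minimal_blowup_holds` / `rusin_sverak_minimal_data_compact_holds`) hand us a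
distinguished COMPACT object: the quotient M̂ = M/Sim of the minimal blow-up data by translations
and scalings, a compact metric space on which O(3) acts continuously and isometrically because
rotations commute with the flow; an axisymmetric minimal datum is exactly a fixed point of the
circle T = SO(2)_{e₃} on M̂, so AXB is a FIXED-POINT PROBLEM FOR A TORUS ACTION ON A COMPACT SPACE —
the province of P. A. Smith / Borel theory (AlldayPuppe1993 Cor 3.1.13 p.136: finitely many orbit
types + finite rational type ⇒ χ(M̂^T) = χ(M̂); Q-acyclic ⇒ fixed point; the Z_p versions
1.4.7/3.1.10 give p-fold symmetric data from F_p-acyclicity) and of symmetric criticality for its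
variational shadow (sub-threshold maximisers of the dissipation functional J(u₀) =
∫₀^∞‖u‖²_{Ḣ^{3/2}}). In the solved sibling — mass-critical NLS — the minimal blow-up objects ARE the
symmetric ones (Merle, Duke 69 (1993), doi:10.1215/S0012-7094-93-06919-0; Killip–Li–Visan–Zhang
arXiv:0804.1124), which is the transplanted heuristic "ground states are radial". The route
therefore factors Clay (A) as (symmetric data are extremal for blow-up) × (symmetric data are
regular), and the second factor lives in the one class where structure exists: Γ = r u_θ obeys a
maximum principle, Type I is excluded (KNSS2009 Thms 6.1–6.2, SereginSverak2009 Thm 3.1 = barrier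
AxisymmetricTypeIExclusion, ChenStrainTsaiYau2009), and critical regularity criteria in Γ alone are
known (LeiZhang2011 and sequels). Imported areas with dictionary: compact transformation groups
(Smith–Borel fixed-point theorems, Fadell–Rabinowitz index; G-space ↦ M̂, fixed set ↦ symmetric
minimal data, orbit types ↦ pointwise symmetry groups of data: never SO(3) since an
SO(3)-equivariant divergence-free field is c x/|x|³ ∉ L³, orbits of dimension 2 or 3),
critical-element theory (Kenig–Koch arXiv:0908.3349, Gallagher–Koch–Planchon arXiv:1012.0145,
JiaSverak2013) for the description of M̂. No current route uses either the object M̂ or a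
fixed-point theorem; SymmetryModuliCount forces symmetry of Type-I ANCIENT elements and still needs
NoTypeII, whereas here no Type-I/Type-II split and no Liouville conjecture enters; the retired AX
routes (SwirlSignGeometry, KnvAxisInflow) stopped at AX with no assembly to A — AXB is that missing,
non-tautological assembly.

RANKED CRUXES. #0 Thesis (target) — X = AXB ∧ AX_H as in § Thesis (AXB: Clay (A) fails at viscosity
ν ⇒ an axisymmetric minimal blow-up datum exists; AX_H = AxisymmetricKatoGlobal); axisymmetry
written out as rotation-equivariance (`IsAxisymmetric` unfolded, `Iff.rfl`). (why it might fail: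
given AX_H, AXB is equivalent to Clay (A) at ν: if Hou's axisymmetric interior scenario
(arXiv:2107.06509) is real, AX_H is false and the route dies with Clay (A).) [RusinSverak2011,
arXiv:0911.0500, KNSS2009, Hou2022PotentiallySingularNS]
#2 MinimalDatumPFold (crux) — fixed-point output of Smith theory on M̂ = M/Sim (2001 dictionary:
SYM_∃ ⇔ M contains p-fold symmetric data for infinitely many p), stated from the CLAY FAILURE itself
so that the deciding theorem is pure logic (rev 2): for every ν > 0, if some Clay datum (smooth,
divergence-free, rapidly decaying) admits NO jointly smooth bounded-energy global solution at
viscosity ν — hence, routinely and with PROVED tree facts only, no global Kato solution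
(`clay_solution_of_hasGlobalKatoSolution_holds`), ρ_max^pure(ν) ≤ ‖g‖ₑ < ⊤ (ClayDatumCritical +
`hasGlobalKatoSolution_of_lt_rusinSverakRhoMaxPure`) and Rusin–Šverák's M ≠ ∅, compact mod Sim
(`rusin_sverak_minimal_blowup_holds`, `rusin_sverak_minimal_data_compact_holds`) — then for every N
there are p ≥ max(N,2) and a minimal blow-up datum (u₀,g) (`IsMinimalBlowupDatum ν u₀ g`) with u₀
equivariant under the rotation by 2π/p about the x₂-axis through the origin, R_θ x = (cos θ x₀ − sin
θ x₁, sin θ x₀ + cos θ x₁, x₂) (= `u₀ (rotZ (2π/p) x) = rotZ (2π/p) (u₀ x)` unfolded, `rfl`; WLOG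
this axis by rotation/translation invariance of M). [difficulty: XL] (why it might fail: M̂ may be a
finite union of free-ish orbits (types SO(3)/Γ) with χ = 0 and no F_p-acyclicity, where every
cohomological criterion collapses to the claim itself (2001 dictionary); necklaces of p far copies
cost → √p·ρ_max and need not blow up; no analytic description of M̂ exists.) [RusinSverak2011,
AlldayPuppe1993, JiaSverak2013, arXiv:1012.0145, arXiv:0908.3349, arXiv:0804.1124]
#3 AxisymmetricKatoGlobal (crux) — AX in the critical class (implies the conjecture leaf
`Summit.NavierStokesRegularity.NavierStokesRegularity.AxisymmetricSwirlRegularity` via the proved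
Kato→Clay fact; only its threshold instance — no axisymmetric MINIMAL blow-up datum — is consumed by
`closes`). For every ν > 0, every L³ field u₀ represented in Ḣ^{1/2}, weakly divergence-free and
axisymmetric about the x₂-axis (∀ θ x, u₀ (R_θ x) = R_θ (u₀ x), = `IsAxisymmetric u₀` unfolded,
`Iff.rfl`), has a global Kato solution (C([0,∞);L³) mild). [difficulty: open-problem] (why it might
fail: = axisymmetric-with-swirl regularity (open since Ladyzhenskaya 1968), here even without Γ = r
u_θ ∈ L^∞ at t = 0; Hou's two-scale axisymmetric tornado (arXiv:2107.06509) would refute it; known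
only for no swirl, |u| ≤ C/r (KNSS Thm 5.3) or log-small Γ modulus (Lei–Zhang line).) [KNSS2009,
SereginSverak2009, ChenStrainTsaiYau2009, LeiZhang2011, Hou2022PotentiallySingularNS,
Literature.Barriers.NavierStokesRegularity.AxisymmetricTypeIExclusion]
#4 PFoldToAxisymmetric (crux) — compactness upgrade (2001 dictionary row "lim ρ_p = ρ_ax",
claim-level there). For ν > 0: if for unboundedly many p ≥ 2 there are p-fold symmetric minimal
blow-up data (equivariance under R_{2π/p} as in #2), then an axisymmetric minimal blow-up datum
exists (equivariance under every R_θ) — modulate by Rusin–Šverák compactness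
(`rusin_sverak_minimal_data_compact`, PROVED), pass to an Ḣ^{1/2}-limit, and show the limit is
invariant under the closure of ∪ Z_{p_j} = SO(2) about a limiting axis. [deps: MinimalDatumPFold]
[difficulty: M] (why it might fail: compactness is modulo Sim only: the modulated symmetry axes may
escape to infinity with angle step 2π d_j/p_j ↛ 0, leaving no invariance in the limit; an
axis-pinning lemma (symmetric minimal data concentrate within O(scale) of their axis) is needed and
unproved.) [RusinSverak2011, arXiv:0911.0500, arXiv:1012.0145, AlldayPuppe1993]
#9 ClayDatumCritical (support) — a Clay datum is a critical datum: smooth + divergence-free +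
rapidly decaying ⇒ u₀ ∈ L³, weakly divergence-free, and represented by some g ∈ Ḣ^{1/2} (rapid decay
⇒ H^∞ ⇒ Ḣ^{1/2} ∩ L² by `MemHomSobolev.of_le`; `HomSobolev.represents_ofFun_holds`;
`VectorCalculus.IsDivFree.isWeaklyDivFree_holds`). Glue consumed inside the proof of
MinimalDatumPFold, not by `closes`. PROOF HYGIENE (cone): the Theorems file proving it should import
the lightest modules carrying those `_holds` facts (CriticalSpaces / FourierSobolev / VectorCalculus
files), NOT `Theorems.TypeICertificateLadderNoBlowupToClay` or `NSKatoToClayHolds`, whose import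
closures carry unrelated unproved named facts — every `_holds` link the gate appends re-enters this
route file's import cone. [difficulty: provable-now] [LemarieRieusset2016, Kato1984,
RusinSverak2011]
(rev 2: the former support item KatoToClay — verbatim the PROVED fact
`Literature.Analysis.FluidPDE.clay_solution_of_hasGlobalKatoSolution`, shared item
stmt-NavierStokesRegularity-10568 of AmplitudeIndex/MarginalTypeI — is DROPPED from this route:
`closes` no longer needs it, and its one-line proof imports `NSKatoToClayHolds`, whose closure
(TaoClassGlue → NSCriticalClosure*/NSLerayHopfSeregin*) would put gkp_besov_blowup,
albritton_besov_blowup, EnergyClassNonUniqueness, LerayHopfNonUniqueness, albritton_brue_colombo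
back into the import cone; provers cite the fact by name inside MinimalDatumPFold's proof.)

TWO-LAYER PLAN. MinimalDatumPFold ⇐ [routine front end, provable now: Clay failure ⇒ ρ_max^pure(ν) <
⊤ ∧ M ≠ ∅ compact, by Kato→Clay + ClayDatumCritical + Rusin–Šverák, all PROVED] →
MinimalModuliAcyclic (M̂ := M/Sim with the quotient Ḣ^{1/2} topology is connected and F_p-acyclic
for infinitely many primes p — needs the definition request below) → SmithStep (Smith's theorem for
Z_p ⊂ SO(2) on the compact finitistic space M̂, AlldayPuppe1993 (1.4.7)/(3.1.10)) →
MinimalDatumPFold; ALTERNATIVE decomposition of the same node (variational, 2001 row (GS)):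
SubthresholdMaximisers (maximisers of J on {‖u₀‖ ≤ ρ_k}, ρ_k ↑ ρ_max, exist by profile
decomposition) → SymmetricCriticalityUnique (they are axisymmetric by symmetric criticality +
uniqueness) → MinimalDatumPFold. AxisymmetricKatoGlobal ⇐ AxisymThresholdTypeI (a minimal
axisymmetric blow-up has a Type-I point: threshold dynamics is the mildest) →
knss_no_axisymmetric_typeI (barrier AxisymmetricTypeIExclusion, PROVED direction) → contradiction —
i.e. the 2001 junction "(SYM) ∧ (TR_min) ∧ B ≠ ∅ is contradictory", which would replace AX_H by a
threshold-only statement. PFoldToAxisymmetric ⇐ AxisPinning → ClosedSubgroupLimit →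
PFoldToAxisymmetric (k = 2).

KILL CRITERIA. (i) A finite-energy axisymmetric blow-up from smooth decaying data (Hou's scenario
certified) refutes AxisymmetricKatoGlobal — close `refuted:AxisymmetricKatoGlobal`; this is ¬Clay
(A) territory (hand to CertifiedBlowup). (ii) A theorem "M̂ is a finite union of orbits none of
which is fixed by a circle" cannot be proved without exhibiting blow-up, but a MODEL refutation — a
compact Sim-invariant set of Ḣ^{1/2} fields carrying p_j-fold symmetric elements for p_j → ∞ and no
axisymmetric element — refutes PFoldToAxisymmetric as typed (it quantifies over M only, so the model
must be M itself; a refuter would instead show the implication fails for general compact O(3)-spaces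
of fields and force the axis-pinning hypothesis into the statement: pivot by `--restate
PFoldToAxisymmetric` with the pinning clause). (iii) MinimalDatumPFold refuted (minimal data exist
but none p-fold for large p) ⇒ the extremality thesis is false: close `refuted:MinimalDatumPFold`;
the by-product "extremal blow-up is genuinely three-dimensional" is banked for the negative side
(cf. one-component pincer: Type-I singular points are 3-D in every frame). (iv) ρ_max^pure = ⊤
proved elsewhere (MarginalTypeI, AmplitudeIndex, ThinOrFatPincer) moots the route.

NOT DECOMPOSED YET. The topology of M̂ (which cohomology: Čech with Q / F_p coefficients on a
compact metric space; finitely many orbit types from the isotropy classification S², RP²,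
SO(3)/finite) and the Smith step itself — layer-2 children of MinimalDatumPFold once the definition
of M̂ as a topological O(3)-space lands; the 2001 UNTRIED inputs, verbatim: "non-enumerative
description of M̂ (via the profile decomposition), symmetrisation, robustness of blow-up under
adding far profiles (ρ_p < ∞ for one p ≥ 2), Fredholm structure"; the variational shadow (GS) and
the errata E1/E2 of the 2001 Prop `prop:var` (TFAE needs stability under u ↦ cu, c ∈ (0,1]; the 𝔄_p
'iff' only for ρ < √p·ρ_max); the axis-pinning lemma inside PFoldToAxisymmetric; whether AX_H can be
weakened to its threshold instance or to data with bounded swirl (Kato smoothing does not give Γ ∈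
L^∞); the finite-energy transcription (`RusinSverakQuestion`) — irrelevant here because everything
is stated with the pure threshold. IMPORT CONE (rev 2 cone repair): the route file imports only
`Literature.Analysis.FluidPDE.MildSolutions` and `…RusinSverakCompactness` (27 project modules); of
the 7 unproved named facts of rev 1's cone, 5 left with `NSKatoToClayHolds` (gkp_besov_blowup,
albritton_besov_blowup, EnergyClassNonUniqueness, LerayHopfNonUniqueness, albritton_brue_colombo —
none used by any item), 1 with `AxisymmetricEuler` → `Vorticity`
(`IsVorticitySolutionOn.exists_pressure`, a @[deprecated] tombstone REFUTED AS STATED by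
`not_isVorticitySolutionOn_exists_pressure` — never provable, census-side clean-up), and exactly 1
is irreducible route-side: `Literature.Analysis.FluidPDE.RusinSverakQuestion`, an `@[conjecture]`
OPEN statement (verdict MARK-OPEN 2026-08-16) that merely shares MildSolutions.lean with
`HasGlobalKatoSolution` / `rusinSverakRhoMaxPure`; no item reaches it (used-constants cone: 0
unproved) and the route does NOT need it — needs-fact: none; the fix for that last entry is
librarian/census-side (relocate the conjecture to a leaf file, or stop counting @[conjecture] defs
as cone debt).

CHEAPEST FALSIFIER. For PFoldToAxisymmetric: build, in Ḣ^{1/2}(ℝ³), p_j-fold symmetric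
divergence-free fields (p_j bumps on a circle of radius R_j) whose Sim-modulations converge strongly
but to a NON-axisymmetric limit — if such a sequence exists inside a compact Sim-invariant set, the
escaping-axis objection is real and the crux must carry an axis-pinning hypothesis. Tried by hand
(20 min): strong convergence after modulation forces either concentration on one bump (then the
other p_j − 1 bumps must vanish in norm, contradicting symmetry and ‖·‖ = ρ_max) or a ring-like
limit (axisymmetric); no counterexample found — refuters should redo it with two radii / staggered
necklaces. For MinimalDatumPFold the cheapest check is the orbit-type bookkeeping: confirm that
SO(3) ⊄ isotropy (c x/|x|³ ∉ L³) and that O(2)-type orbits are exactly the axisymmetric data, so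
that "orbit-finite M̂ without circle-fixed points" is a consistent scenario the crux must exclude by
analysis, not topology alone.

NUMBERS. ρ_max^pure(ν) ≥ δν > 0 (Fujita–Kato; `fujita_kato_global_small`), ρ_max^pure(ν) = ν
ρ_max^pure(1) (`rusinSverakRhoMaxPure_eq_mul_holds`); orbits in M̂ have dimension 2 or 3, isotropy
never ⊇ SO(3) (2001 structure row, refereed "no gap"); Fadell–Rabinowitz S¹-index of M̂ ≥ 2
unconditionally, ≥ 3 only if SYM_∃ or infinitely many non-congruent minimal data (2001,
claim-level); gap sequence ρ_p ∈ [ρ_max, ∞], ρ_p ≤ ρ_q if p | q, lim ρ_p = ρ_ax, ρ_p attained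
whenever ρ_p < √p·ρ_max (2001, claim-level). Items at open: 7 (target, assembly, 3 cruxes, 2
support); after rev 2: 6 (target, assembly, 3 cruxes, 1 support). Import cone after rev 2: 27
project modules, 1 unproved named fact (the unreachable conjecture RusinSverakQuestion),
used-constants cone 0 unproved.

DEFINITION REQUESTS. MinimalDataModuli ν — the quotient M̂ of {(u₀, g) : IsMinimalBlowupDatum ν u₀
g} by translations and scalings with the quotient of the Ḣ^{1/2} topology, as a `TopologicalSpace`
with the induced continuous O(3)-action (topic
Summits/NavierStokesRegularity/NavierStokesRegularity/Theorems; for the layer-2 child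
MinimalModuliAcyclic). Cite fact wanted: P. A. Smith / Borel fixed-point theorem for Z_p- and circle
actions on compact finitistic spaces (AlldayPuppe1993 Cor 1.4.7, Thm 3.1.10, Cor 3.1.13 p.136) —
Mathlib has no Čech cohomology, so it would enter as a named hypothesis of SmithStep.

Novelty: Searches (2026-08-16; local searchd down, OpenAlex/S2/arXiv rate-limited — recorded in NOTES.md):
`lit citing arXiv:0911.0500 -n 60` (62 works citing Rusin–Šverák: Jia–Šverák arXiv:1201.1592, GKP
arXiv:1407.4156/1012.0145, Barker–Prange, Palasek arXiv:2509.18595, NLS transfer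
doi:10.1080/00036811.2019.1636972 — none on symmetry of minimal data); `lit search --source crossref
"Smith fixed point theorem blow-up symmetric solution"` (0 relevant); `lit search --source zbmath
"minimal blow-up data symmetric"` (KLVZ arXiv:0804.1124, minimal-mass NLS characterisation = the
sibling precedent); `lit read arxiv:0911.0500 --grep symmetr` (0 hits: the paper says nothing on
symmetry of M); grep of all 63 route files + 157 idea cards for Smith|Borel|Fadell|fixed-point|Rusin
(no route/card uses a fixed-point theorem on M; MinimalBlowupRigidity closed/superseded was
Kenig–Merle rigidity); held book AlldayPuppe1993 read pp.39–43, 136 for the theorem numbers. Prior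
programme: `summits/ns/routes/minimal-blowup-symmetry` (2001, STATUS proving, internal, unreviewed
beyond junction rows) — the source of the lever, resurrected and re-typed here.
Nearest prior art found: RusinSverak2011 (arXiv:0911.0500 Cor 4.3: M non-empty, compact mod Sim — no
symmetry statement); KLVZ arXiv:0804.1124 + Merle 1993 (minimal-mass NLS blow-up is ground-state,
i.e. symmetric — the analogue, by explicit characterisation not by fixed-point theory); in tree
SymmetryModuliCount (forced symmetry of Type-I ancient elements  [refs: 10.1080/00036811.2019.1636972, 0911.0500, 1201.1592, 1407.4156, 2509.18595, 0804.1124, doi:10.1080/00036811.2019.1636972, arxiv:0911.0500, AlldayPuppe1993, RusinSverak2011]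

Barriers (technique_class: equivariant-topology symmetry-reduction): - technique_class: equivariant-topology symmetry-reduction
- Literature.Barriers.NavierStokesRegularity.EnergySupercriticality: it does not bite on AXB (a
topological statement about a compact set in the CRITICAL space, no energy-class quantity is used
coercively); it bites head-on on AxisymmetricKatoGlobal, a critical regularity claim — the bet there
is structure, not energy: the maximum principle for Γ = r u_θ and the Type-I exclusion in the
axisymmetric class.
- Literature.Barriers.NavierStokesRegularity.TaoAveragedBlowup: the Smith lever needs EXACT
rotation-equivariance of the solution map and strong compactness of M (energy inequality +
weak–strong stability, Rusin–Šverák §4), and AX_H needs the scalar Γ with its maximum principle;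
Tao's averaged bilinear forms are built on anisotropic frequency circuits and carry neither the
swirl max principle nor (generically) SO(2)-equivariance — conceded that an equivariant averaged
equation with blow-up would leave AXB formally intact and kill only AX_H-type arguments.
- Literature.Barriers.NavierStokesRegularity.AxisymmetricTypeIExclusion: consistent and USED: the
axisymmetric minimal datum produced by AXB can blow up only at Type II, which is what the Two-layer
alternative (AxisymThresholdTypeI) would contradict; it threatens nothing here.
- Literature.Barriers.NavierStokesRegularity.CriticalDataSmoothNonuniqueness: not applicable — Kato
(C_t L³) solutions from L³ ⊃ Ḣ^{1/2} data are unique (`kato_unique_holds`); the Coiculescu–P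

History (route lifecycle, newest last):
- 2026-08-16T15:23:39Z · rev 1: restated MinimalDatumPFold (stmt-NavierStokesRegularity-15303) — rev 1: crux-only deciding theorem (glue.non-crux-hypothesis repair) + Clay-side restatement of MinimalDatumPFold + import NSKatoToClayHolds (planner-plan-lens-NavierStokesRegularity-resurrect2001-0)
- 2026-08-16T15:40:53Z · rev 2: restated Thesis (stmt-NavierStokesRegularity-15302), MinimalDatumPFold (stmt-NavierStokesRegularity-15351), AxisymmetricKatoGlobal (stmt-NavierStokesRegularity-15304), PFoldToAxisymmetric (stmt-NavierStokesRegularity-15305), Assembly (stmt-NavierStokesRegularity-15307) — rev 2 (cone repair, planner-rrepair-…-8d4 (planner-rrepair-NavierStokesRegularity-Axisymm-8d4d02a1-0)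
- 2026-08-16T15:40:53Z · rev 2: dropped KatoToClay — rev 2 (cone repair, planner-rrepair-…-8d4d02a1-0): import cone 7 unproved named facts → 1. (a) `closes` is now PURE LOGIC (by_contra on the Clay conclusion): Mi (planner-rrepair-NavierStokesRegularity-Axisymm-8d4d02a1-0)
- 2026-08-16T15:42:44Z · rev 3: restated Thesis (stmt-NavierStokesRegularity-15451) — rev 3 (cone repair follow-up): Thesis (target) Lean term now carries the CLAY-FAILURE antecedent in its AXB half (rev 2 left the old ρ_max^pure(ν) < ⊤ anteceden (planner-rrepair-NavierStokesRegularity-Axisymm-8d4d02a1-0)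
- 2026-08-26T03:35:19Z · DORMANT — reconciler: no traction for 8.3 d (last activity item-evidence-added at 2026-08-17T19:20:11Z); parked, not closed — `ledger route dormant route-NavierStokesRegu (operator:999:2132322)
- 2026-08-26T16:15:13Z · REACTIVATED — reconciler: reactivated — activity item-proof-filed at 2026-08-26T15:31:37Z after parking at 2026-08-26T03:35:19Z (operator:999:419805)
- 2026-09-04T08:37:37Z · DORMANT — reconciler: no traction for 5 d (last activity item-evidence-added at 2026-08-30T07:51:28Z); parked, not closed — `ledger route dormant route-NavierStokesRegula (operator:999:476218)

sub-problem: NavierStokesRegularity · status: dormant · opened planner-plan-lens-NavierStokesRegularity-resurrect2001-0 2026-08-16T15:21:34Z · rev 3 · ledger route-NavierStokesRegularity-AxisymmetricExtremality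
GENERATED by the gate from the ledger (D-0016/17). Provers cite these decls: `theorem foo : Summit.NavierStokesRegularity.NavierStokesRegularity.Theses.AxisymmetricExtremality.<Decl> := …` in Summits/NavierStokesRegularity/NavierStokesRegularity/Theorems/<Name>.lean.
-/

namespace Summit.NavierStokesRegularity.NavierStokesRegularity.Theses.AxisymmetricExtremality

open scoped BigOperators Topology Manifold Classical MeasureTheory ProbabilityTheory Matrix InnerProductSpace ComplexConjugate ContinuousMap
open Filter Set Function TopologicalSpace MeasureTheory

attribute [summit_statement] _root_.NavierStokesRegularity

open Literature.NS

-- earlier Thesis (stmt-NavierStokesRegularity-15302, replaced 2026-08-16T15:40:53Z -> stmt-NavierStokesRegularity-15451): retired by None — (∀ ν : ℝ, 0 < ν → Literature.Analysis.FluidPDE.rusinSverakRhoMaxPure ν < ⊤ → ∃ (u₀ : EuclideanSpace ℝ (Fin 3) → EuclideanSpace ℝ (Fin 3)) (g : Literature.Analysis.FunctionSpaces.HomSobolev (EuclideanSpace ℝ (Fin 3)) (EuclideanSpace ℂ (Fin 3)) (1 / 2 : ℝ)), Liter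
-- earlier Thesis (stmt-NavierStokesRegularity-15451, replaced 2026-08-16T15:42:44Z -> stmt-NavierStokesRegularity-15493): retired by None — (∀ ν : ℝ, 0 < ν → Literature.Analysis.FluidPDE.rusinSverakRhoMaxPure ν < ⊤ → ∃ (u₀ : EuclideanSpace ℝ (Fin 3) → EuclideanSpace ℝ (Fin 3)) (g : Literature.Analysis.FunctionSpaces.HomSobolev (EuclideanSpace ℝ (Fin 3)) (EuclideanSpace ℂ (Fin 3)) (1 / 2 : ℝ)), Liter
/-- item stmt-NavierStokesRegularity-15493 · target · rank 0 · open · by planner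
why it might fail: given AX_H, AXB is equivalent to Clay (A) at ν: if Hou's axisymmetric interior scenario (arXiv:2107.06509) is real, AX_H is false and the route dies with Clay (A).
sources: RusinSverak2011, arXiv:0911.0500, KNSS2009, Hou2022PotentiallySingularNS
[target] X = AXB ∧ AX_H as in § Thesis. AXB: for every ν > 0, if Clay (A) fails at viscosity ν —
some smooth divergence-free rapidly decaying datum has no jointly smooth bounded-energy global
solution (verbatim the negated Clay conclusion, the same antecedent as MinimalDatumPFold) — then an
axisymmetric Rusin–Šverák minimal blow-up datum exists; AX_H = AxisymmetricKatoGlobal. Cruxes ⇒ X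
and X ⇒ NavierStokesRegularity are both pure logic (Sketch2.lean: `thesisR_of_cruxes`,
`statement_of_thesisR`). rev 3 fixes rev 2's leftover ρ_max^pure(ν) < ⊤ antecedent in the Lean term
(the informal text already said Clay failure; ρ_max^pure < ⊤ ⇒ Clay failure is NOT routine because
the blow-up set is closed, not open, in Ḣ^{1/2}, so that form was not implied by the cruxes).
Axisymmetry written out as equivariance under R_θ x = (cos θ x₀ − sin θ x₁, sin θ x₀ + cos θ x₁,
x₂), i.e. `Literature.Analysis.FluidPDE.IsAxisymmetric u₀` unfolded (Iff.rfl). -/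
@[route_item "route-NavierStokesRegularity-AxisymmetricExtremality"]
def Thesis : Prop :=
  (∀ ν : ℝ, 0 < ν → (∃ v₀ : EuclideanSpace ℝ (Fin 3) → EuclideanSpace ℝ (Fin 3), ContDiff ℝ (⊤ : ℕ∞) v₀ ∧ Literature.Analysis.FluidPDE.NSWave0.IsDivFree v₀ ∧ Literature.Analysis.FluidPDE.HasRapidSpatialDecay v₀ ∧ ¬ ∃ (u : ℝ → EuclideanSpace ℝ (Fin 3) → EuclideanSpace ℝ (Fin 3)) (p : ℝ → EuclideanSpace ℝ (Fin 3) → ℝ), Literature.Analysis.FluidPDE.IsSmoothOnHalfSpace u ∧ Literature.Analysis.FluidPDE.IsSmoothOnHalfSpace p ∧ Literature.Analysis.FluidPDE.IsNavierStokesSolution ν 0 v₀ u p ∧ Literature.Analysis.FluidPDE.HasBoundedEnergy u) → ∃ (u₀ : EuclideanSpace ℝ (Fin 3) → EuclideanSpace ℝ (Fin 3)) (g : Literature.Analysis.FunctionSpaces.HomSobolev (EuclideanSpace ℝ (Fin 3)) (EuclideanSpace ℂ (Fin 3)) (1 / 2 : ℝ)), Literature.Analysis.FluidPDE.IsMinimalBlowupDatum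 ν u₀ g ∧ ∀ (θ : ℝ) (x : EuclideanSpace ℝ (Fin 3)), u₀ (WithLp.toLp 2 ![Real.cos θ * x 0 - Real.sin θ * x 1, Real.sin θ * x 0 + Real.cos θ * x 1, x 2]) = WithLp.toLp 2 ![Real.cos θ * u₀ x 0 - Real.sin θ * u₀ x 1, Real.sin θ * u₀ x 0 + Real.cos θ * u₀ x 1, u₀ x 2]) ∧ (∀ ν : ℝ, 0 < ν → ∀ (u₀ : EuclideanSpace ℝ (Fin 3) → EuclideanSpace ℝ (Fin 3)) (g : Literature.Analysis.FunctionSpaces.HomSobolev (EuclideanSpace ℝ (Fin 3)) (EuclideanSpace ℂ (Fin 3)) (1 / 2 : ℝ)), MeasureTheory.MemLp u₀ 3 MeasureTheory.volume → g.Represents (Literature.Analysis.FunctionSpaces.EuclideanSpace.complexify ∘ u₀) → Literature.Analysis.FluidPDE.IsWeaklyDivFree u₀ → (∀ (θ : ℝ) (x : EuclideanSpace ℝ (Fin 3)), u₀ (WithLp.toLp 2 ![Real.cos θ * x 0 - Real.sin θ * x 1, Real.sin θ * x 0 + Real.cos θ * x 1, x 2]) = WithLp.toLp 2 ![Real.cos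 θ * u₀ x 0 - Real.sin θ * u₀ x 1, Real.sin θ * u₀ x 0 + Real.cos θ * u₀ x 1, u₀ x 2]) → Literature.Analysis.FluidPDE.HasGlobalKatoSolution ν u₀)

-- earlier MinimalDatumPFold (stmt-NavierStokesRegularity-15303, replaced 2026-08-16T15:23:39Z -> stmt-NavierStokesRegularity-15351): retired by None — ∀ ν : ℝ, 0 < ν → Literature.Analysis.FluidPDE.rusinSverakRhoMaxPure ν < ⊤ → ∀ N : ℕ, ∃ p : ℕ, N ≤ p ∧ 2 ≤ p ∧ ∃ (u₀ : EuclideanSpace ℝ (Fin 3) → EuclideanSpace ℝ (Fin 3)) (g : Literature.Analysis.FunctionSpaces.HomSobolev (EuclideanSpace ℝ (Fin 3)) (E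
-- earlier MinimalDatumPFold (stmt-NavierStokesRegularity-15351, replaced 2026-08-16T15:40:53Z -> stmt-NavierStokesRegularity-15452): retired by None — ∀ ν : ℝ, 0 < ν → (∃ v₀ : EuclideanSpace ℝ (Fin 3) → EuclideanSpace ℝ (Fin 3), ContDiff ℝ (⊤ : ℕ∞) v₀ ∧ Literature.Analysis.FluidPDE.NSWave0.IsDivFree v₀ ∧ Literature.Analysis.FluidPDE.HasRapidSpatialDecay v₀ ∧ ¬ Literature.Analysis.FluidPDE.HasGlobalK
/-- item stmt-NavierStokesRegularity-15452 · crux · rank 2 · open · by planner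
why it might fail: M̂ may be a finite union of free-ish orbits (types SO(3)/Γ) with χ = 0 and no F_p-acyclicity, where every cohomological criterion collapses to the claim itself (2001 dictionary); necklaces of p far copies cost → √p·ρ_max and need not blow up; no analytic description of M̂ exists.
sources: RusinSverak2011, AlldayPuppe1993, JiaSverak2013, arXiv:1012.0145, arXiv:0908.3349, arXiv:0804.1124
[crux] fixed-point output of Smith theory on M̂ = M/Sim (2001 dictionary: SYM_∃ ⇔ M contains p-fold
symmetric data for infinitely many p), stated from the CLAY FAILURE itself so that the deciding
theorem is pure logic (rev 2): for every ν > 0, if some Clay datum (smooth, divergence-free, rapidly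
decaying) admits no jointly smooth bounded-energy global solution at viscosity ν — hence, routinely
and by PROVED tree facts only, no global Kato solution
(`clay_solution_of_hasGlobalKatoSolution_holds`), ρ_max^pure(ν) ≤ ‖g‖ₑ < ⊤ (ClayDatumCritical +
`hasGlobalKatoSolution_of_lt_rusinSverakRhoMaxPure`), and Rusin–Šverák's M ≠ ∅, compact mod Sim
(`rusin_sverak_minimal_blowup_holds`, `rusin_sverak_minimal_data_compact_holds`) — then for every N
there are p ≥ max(N,2) and a minimal blow-up datum (u₀,g) (`IsMinimalBlowupDatum ν u₀ g`) with u₀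
equivariant under the rotation by 2π/p about the x₂-axis through the origin, written out as R_θ x =
(cos θ x₀ − sin θ x₁, sin θ x₀ + cos θ x₁, x₂), θ = 2π/p (= `u₀ (rotZ (2π/p) x) = rotZ (2π/p) (u₀
x)` unfolded, rfl; WLOG this axis by rotation/translation invariance of M). Sources: RusinSverak2011
Cor 4.3; AlldayPuppe1993 (1.4.7), (3.1.10), Cor 3.1.13 p.13 -/
@[route_item "route-NavierStokesRegularity-AxisymmetricExtremality"]
def MinimalDatumPFold : Prop :=
  ∀ ν : ℝ, 0 < ν → (∃ v₀ : EuclideanSpace ℝ (Fin 3) → EuclideanSpace ℝ (Fin 3), ContDiff ℝ (⊤ : ℕ∞) v₀ ∧ Literature.Analysis.FluidPDE.NSWave0.IsDivFree v₀ ∧ Literature.Analysis.FluidPDE.HasRapidSpatialDecay v₀ ∧ ¬ ∃ (u : ℝ → EuclideanSpace ℝ (Fin 3) → EuclideanSpace ℝ (Fin 3)) (p : ℝ → EuclideanSpace ℝ (Fin 3) → ℝ), Literature.Analysis.FluidPDE.IsSmoothOnHalfSpace u ∧ Literature.Analysis.FluidPDE.IsSmoothOnHalfSpace p ∧ Literature.Analysis.FluidPDE.IsNavierStokesSolution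 ν 0 v₀ u p ∧ Literature.Analysis.FluidPDE.HasBoundedEnergy u) → ∀ N : ℕ, ∃ p : ℕ, N ≤ p ∧ 2 ≤ p ∧ ∃ (u₀ : EuclideanSpace ℝ (Fin 3) → EuclideanSpace ℝ (Fin 3)) (g : Literature.Analysis.FunctionSpaces.HomSobolev (EuclideanSpace ℝ (Fin 3)) (EuclideanSpace ℂ (Fin 3)) (1 / 2 : ℝ)), Literature.Analysis.FluidPDE.IsMinimalBlowupDatum ν u₀ g ∧ ∀ x : EuclideanSpace ℝ (Fin 3), u₀ (WithLp.toLp 2 ![Real.cos (2 * Real.pi / p) * x 0 - Real.sin (2 * Real.pi / p) * x 1, Real.sin (2 * Real.pi / p) * x 0 + Real.cos (2 * Real.pi / p) * x 1, x 2]) = WithLp.toLp 2 ![Real.cos (2 * Real.pi / p) * u₀ x 0 - Real.sin (2 * Real.pi / p) * u₀ x 1, Real.sin (2 * Real.pi / p) * u₀ x 0 + Real.cos (2 * Real.pi / p) * u₀ x 1, u₀ x 2]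

-- earlier AxisymmetricKatoGlobal (stmt-NavierStokesRegularity-15304, replaced 2026-08-16T15:40:53Z -> stmt-NavierStokesRegularity-15453): retired by None — ∀ ν : ℝ, 0 < ν → ∀ (u₀ : EuclideanSpace ℝ (Fin 3) → EuclideanSpace ℝ (Fin 3)) (g : Literature.Analysis.FunctionSpaces.HomSobolev (EuclideanSpace ℝ (Fin 3)) (EuclideanSpace ℂ (Fin 3)) (1 / 2 : ℝ)), MeasureTheory.MemLp u₀ 3 MeasureTheory.volume → g
/-- item stmt-NavierStokesRegularity-15453 · crux · rank 3 · open · by planner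
why it might fail: = axisymmetric-with-swirl regularity (open since Ladyzhenskaya 1968), here even without Γ = r u_θ ∈ L^∞ at t = 0; Hou's two-scale axisymmetric tornado (arXiv:2107.06509) would refute it; known only for no swirl, |u| ≤ C/r (KNSS Thm 5.3) or log-small Γ modulus (Lei–Zhang line).
sources: KNSS2009, SereginSverak2009, ChenStrainTsaiYau2009, LeiZhang2011, Hou2022PotentiallySingularNS, Literature.Barriers.NavierStokesRegularity.AxisymmetricTypeIExclusion
[crux] AX in the critical class (implies the conjecture leaf
`Summit.NavierStokesRegularity.NavierStokesRegularity.AxisymmetricSwirlRegularity` via the proved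
Kato→Clay fact; only its threshold instance — no axisymmetric MINIMAL blow-up datum — is consumed by
`closes`). For every ν > 0, every L³ field u₀ represented in Ḣ^{1/2}, weakly divergence-free and
axisymmetric about the x₂-axis — written out as equivariance u₀ (R_θ x) = R_θ (u₀ x) for all θ, R_θ
x = (cos θ x₀ − sin θ x₁, sin θ x₀ + cos θ x₁, x₂), which is
`Literature.Analysis.FluidPDE.IsAxisymmetric u₀` unfolded (Iff.rfl; rev 2, keeps
AxisymmetricEuler/Vorticity out of the import cone) — has a global Kato solution (C([0,∞);L³) mild).
[difficulty: open-problem] -/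
@[route_item "route-NavierStokesRegularity-AxisymmetricExtremality"]
def AxisymmetricKatoGlobal : Prop :=
  ∀ ν : ℝ, 0 < ν → ∀ (u₀ : EuclideanSpace ℝ (Fin 3) → EuclideanSpace ℝ (Fin 3)) (g : Literature.Analysis.FunctionSpaces.HomSobolev (EuclideanSpace ℝ (Fin 3)) (EuclideanSpace ℂ (Fin 3)) (1 / 2 : ℝ)), MeasureTheory.MemLp u₀ 3 MeasureTheory.volume → g.Represents (Literature.Analysis.FunctionSpaces.EuclideanSpace.complexify ∘ u₀) → Literature.Analysis.FluidPDE.IsWeaklyDivFree u₀ → (∀ (θ : ℝ) (x : EuclideanSpace ℝ (Fin 3)), u₀ (WithLp.toLp 2 ![Real.cos θ * x 0 - Real.sin θ * x 1, Real.sin θ * x 0 + Real.cos θ * x 1, x 2]) = WithLp.toLp 2 ![Real.cos θ * u₀ x 0 - Real.sin θ * u₀ x 1, Real.sin θ * u₀ x 0 + Real.cos θ * u₀ x 1, u₀ x 2]) → Literature.Analysis.FluidPDE.HasGlobalKatoSolution ν u₀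

-- earlier PFoldToAxisymmetric (stmt-NavierStokesRegularity-15305, replaced 2026-08-16T15:40:53Z -> stmt-NavierStokesRegularity-15454): retired by None — ∀ ν : ℝ, 0 < ν → (∀ N : ℕ, ∃ p : ℕ, N ≤ p ∧ 2 ≤ p ∧ ∃ (u₀ : EuclideanSpace ℝ (Fin 3) → EuclideanSpace ℝ (Fin 3)) (g : Literature.Analysis.FunctionSpaces.HomSobolev (EuclideanSpace ℝ (Fin 3)) (EuclideanSpace ℂ (Fin 3)) (1 / 2 : ℝ)), Literature.Analys
/-- item stmt-NavierStokesRegularity-15454 · crux · rank 4 · closed · proved by Summit.NavierStokesRegularity.NavierStokesRegularity.Theorems.axisymmetricExtremality_pFoldToAxisymmetric_proof @ e4adc5df0a57 (prover) · by planner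
why it might fail: compactness is modulo Sim only: the modulated symmetry axes may escape to infinity with angle step 2π d_j/p_j ↛ 0, leaving no invariance in the limit; an axis-pinning lemma (symmetric minimal data concentrate within O(scale) of their axis) is needed and unproved.
sources: RusinSverak2011, arXiv:0911.0500, arXiv:1012.0145, AlldayPuppe1993
[crux] compactness upgrade (2001 dictionary row "lim ρ_p = ρ_ax", claim-level there). For ν > 0: if
for unboundedly many p ≥ 2 there are p-fold symmetric minimal blow-up data (equivariance under
R_{2π/p}, written out as in MinimalDatumPFold), then an axisymmetric minimal blow-up datum exists
(equivariance under every R_θ = `IsAxisymmetric` unfolded, Iff.rfl) — modulate by Rusin–Šverák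
compactness (`rusin_sverak_minimal_data_compact`, PROVED), pass to an Ḣ^{1/2}-limit, and show the
limit is invariant under the closure of ∪ Z_{p_j} = SO(2) about a limiting axis. [deps:
MinimalDatumPFold] [difficulty: M] -/
@[route_item "route-NavierStokesRegularity-AxisymmetricExtremality"]
def PFoldToAxisymmetric : Prop :=
  ∀ ν : ℝ, 0 < ν → (∀ N : ℕ, ∃ p : ℕ, N ≤ p ∧ 2 ≤ p ∧ ∃ (u₀ : EuclideanSpace ℝ (Fin 3) → EuclideanSpace ℝ (Fin 3)) (g : Literature.Analysis.FunctionSpaces.HomSobolev (EuclideanSpace ℝ (Fin 3)) (EuclideanSpace ℂ (Fin 3)) (1 / 2 : ℝ)), Literature.Analysis.FluidPDE.IsMinimalBlowupDatum ν u₀ g ∧ ∀ x : EuclideanSpace ℝ (Fin 3), u₀ (WithLp.toLp 2 ![Real.cos (2 * Real.pi / p) * x 0 - Real.sin (2 * Real.pi / p) * x 1, Real.sin (2 * Real.pi / p) * x 0 + Real.cos (2 * Real.pi / p) * x 1, x 2]) = WithLp.toLp 2 ![Real.cos (2 * Real.pi / p) * u₀ x 0 - Real.sin (2 * Real.pi /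 p) * u₀ x 1, Real.sin (2 * Real.pi / p) * u₀ x 0 + Real.cos (2 * Real.pi / p) * u₀ x 1, u₀ x 2]) → ∃ (u₀ : EuclideanSpace ℝ (Fin 3) → EuclideanSpace ℝ (Fin 3)) (g : Literature.Analysis.FunctionSpaces.HomSobolev (EuclideanSpace ℝ (Fin 3)) (EuclideanSpace ℂ (Fin 3)) (1 / 2 : ℝ)), Literature.Analysis.FluidPDE.IsMinimalBlowupDatum ν u₀ g ∧ ∀ (θ : ℝ) (x : EuclideanSpace ℝ (Fin 3)), u₀ (WithLp.toLp 2 ![Real.cos θ * x 0 - Real.sin θ * x 1, Real.sin θ * x 0 + Real.cos θ * x 1, x 2]) = WithLp.toLp 2 ![Real.cos θ * u₀ x 0 - Real.sin θ * u₀ x 1, Real.sin θ * u₀ x 0 + Real.cos θ * u₀ x 1, u₀ x 2]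

-- `PFoldToAxisymmetric` holds: proved by `Summit.NavierStokesRegularity.NavierStokesRegularity.Theorems.axisymmetricExtremality_pFoldToAxisymmetric_proof` @ e4adc5df0a57 (its module imports this route file, so no `_holds` link can be stated here).

/-- item stmt-NavierStokesRegularity-15306 · support · rank 9 · closed · proved by Summit.NavierStokesRegularity.NavierStokesRegularity.Theorems.axisymmetricExtremality_clayDatumCritical_proof (prover) · by planner
sources: LemarieRieusset2016, Kato1984, RusinSverak2011
[support] a Clay datum is a critical datum: smooth + divergence-free + rapidly decaying ⇒ u₀ ∈ L³,
weakly divergence-free, and represented by some g ∈ Ḣ^{1/2} (rapid decay ⇒ H^∞ ⇒ Ḣ^{1/2} ∩ L² by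
`MemHomSobolev.of_le`; `HomSobolev.represents_ofFun_holds`;
`VectorCalculus.IsDivFree.isWeaklyDivFree_holds`; the L³ step as in
`typeICertificateLadder_noBlowupToClay_proof`). [difficulty: provable-now] -/
@[route_item "route-NavierStokesRegularity-AxisymmetricExtremality"]
def ClayDatumCritical : Prop :=
  ∀ u₀ : EuclideanSpace ℝ (Fin 3) → EuclideanSpace ℝ (Fin 3), ContDiff ℝ (⊤ : ℕ∞) u₀ → Literature.Analysis.FluidPDE.NSWave0.IsDivFree u₀ → Literature.Analysis.FluidPDE.HasRapidSpatialDecay u₀ → MeasureTheory.MemLp u₀ 3 MeasureTheory.volume ∧ Literature.Analysis.FluidPDE.IsWeaklyDivFree u₀ ∧ ∃ g : Literature.Analysis.FunctionSpaces.HomSobolev (EuclideanSpace ℝ (Fin 3)) (EuclideanSpace ℂ (Fin 3)) (1 / 2 : ℝ), g.Represents (Literature.Analysis.FunctionSpaces.EuclideanSpace.complexify ∘ u₀)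

-- `ClayDatumCritical` holds: proved by `Summit.NavierStokesRegularity.NavierStokesRegularity.Theorems.axisymmetricExtremality_clayDatumCritical_proof` (its module imports this route file, so no `_holds` link can be stated here).

-- earlier Assembly (stmt-NavierStokesRegularity-15307, replaced 2026-08-16T15:40:53Z -> stmt-NavierStokesRegularity-15455): retired by None — MinimalDatumPFold → PFoldToAxisymmetric → AxisymmetricKatoGlobal → ClayDatumCritical → KatoToClay → NavierStokesRegularity
/-- item stmt-NavierStokesRegularity-15455 · assembly · rank 1 · closed · proved by Summit.NavierStokesRegularity.NavierStokesRegularity.Theorems.axisymmetricExtremality_assembly_proof (prover) · by planner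
sources: RusinSverak2011, Kato1984
[assembly] MinimalDatumPFold → PFoldToAxisymmetric → AxisymmetricKatoGlobal → NavierStokesRegularity
(rev 2: exactly the deciding theorem `closes`, pure logic by contradiction on the Clay conclusion;
the former support hypotheses ClayDatumCritical / KatoToClay are glue inside MinimalDatumPFold's
proof). -/
@[route_item "route-NavierStokesRegularity-AxisymmetricExtremality"]
def Assembly : Prop :=
  MinimalDatumPFold → PFoldToAxisymmetric → AxisymmetricKatoGlobal → NavierStokesRegularity

-- `Assembly` holds: proved by `Summit.NavierStokesRegularity.NavierStokesRegularity.Theorems.axisymmetricExtremality_assembly_proof` (its module imports this route file, so no `_holds` link can be stated here).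

/-! D-0027 §2.1 — DECIDING THEOREM (planner-authored via `route open/edit --closes-file`; by planner-rrepair-NavierStokesRegularity-Axisymm-8d4d02a1-0 2026-08-16T15:40:53Z):
its hypotheses are this route's items and its conclusion the sub-problem Statement (glue_lint), and it elaborates with this file. -/

@[closes "route-NavierStokesRegularity-AxisymmetricExtremality"] theorem closes (h₂ : MinimalDatumPFold) (h₄ : PFoldToAxisymmetric) (h₃ : AxisymmetricKatoGlobal) :
    NavierStokesRegularity := by
  show Literature.NS.NavierStokesExistenceSmoothR3
  intro ν hν u₀ hsm hdiv hdec
  -- pure logic (rev 2): argue by contradiction on the Clay conclusion itself, so that no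
  -- Literature lemma (and no heavy import) is needed in the route file
  by_contra hno
  -- a Clay datum without a Clay solution yields p-fold symmetric minimal blow-up data (h₂), hence
  -- an axisymmetric minimal blow-up datum (h₄), which AX_H (h₃) makes global: contradiction with
  -- the minimality clause ¬HasGlobalKatoSolution
  obtain ⟨u₁, g, hmin, hax⟩ := h₄ ν hν (h₂ ν hν ⟨u₀, hsm, hdiv, hdec, hno⟩)
  obtain ⟨hL3, hrep, hdiv₁, -, hnot⟩ := hmin
  exact hnot (h₃ ν hν u₁ g hL3 hrep hdiv₁ hax)

end Summit.NavierStokesRegularity.NavierStokesRegularity.Theses.AxisymmetricExtremality
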